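import Summits.AtomisticToContinuum.Crystallization.Theorems.FreeSplittingCertificatesOnPathKernel
import Summits.AtomisticToContinuum.Crystallization.Theorems.FreeSplittingCertificatesAssembly
import Summits.AtomisticToContinuum.Crystallization.Theorems.FreeSplittingCertificatesShellRigidityHcp

/-!
# `StrictSplittingRule` (stmt-AtomisticToContinuum-12560) ON-PATH KERNEL, part 2: the razor note, the doctrine split
# `H ⟸ TP ∧ SEL`, and the OUTRIGHT corollary `H → Crystallization`  (decomp-a2c · lens-6 g28 node, landed by hand-1 g9)

Second module of the landing of lens-6 g28's node `StrictSplittingOnPathKernel.lean` (sha256 9b7472f7…; card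
`NODE-12560.md` 0c290be3…): §§ «razor», «doctrine split» verbatim (defs `fccTarget`, `TwoPatternShellDefectVanish` = TP,
`FccShellsVanish` = SEL, tagged `@[conjecture]`; the node's helper lemmas `shellCloseTo_mono` / `natCard_le_of_imp`
are inlined as local `have`s — their statements duplicate landed tree lemmas, gate `dedup.landed`;
`hcpShellDefectVanish_of_twoPattern_of_fccVanish`,
`twoPattern_of_hcpShellDefectVanish`, `crystallization_of_twoPattern_of_fccVanish`), plus — the 68-module
`FreeSplittingCertificates` cone being built (gate13 2026-08-31T09:21Z) — the corollaries with the four PROVED route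
items `ShellRigidityHcp`, `DefectVanishCrystallizes`, `DefectVanishEnergy`, `PeriodicUpperBound` discharged BY NAME:
`crystallization_of_hcpShellDefectVanish_outright : HcpShellDefectVanish → Crystallization`,
`crystallization_of_strictSplittingRule_outright : StrictSplittingRule → Crystallization` (the crux ALONE closes the
conjunct), `crystallization_of_twoPattern_of_fccVanish_outright : TP → SEL → Crystallization`.
Namespace `…Theorems.StrictSplittingOnPathKernel` unchanged.  No `sorry`.
-/

noncomputable section

namespace Summit.AtomisticToContinuum.Crystallization.Theorems.StrictSplittingOnPathKernel

open scoped BigOperators Topology Classical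
open Filter
open Literature.MathematicalPhysics.StatisticalMechanics
open Literature.Geometry.DiscreteGeometry
open Summit.AtomisticToContinuum.Crystallization.Theses.FreeSplittingCertificates
open Summit.AtomisticToContinuum.Crystallization.Theorems
open Summit.AtomisticToContinuum.Crystallization.Theorems.StrictSplittingRuleBirth

/-! ## The razor on the SURPLUS of 12560 (critic (b)) — a LANDED theorem of the tree, cited by name

`Summit.AtomisticToContinuum.Crystallization.Theorems.StrictSplittingRuleBirth.bravaisGap_of_strictSplittingRule`
(`Theorems/StrictSplittingRule/Negative/FalseOfBravaisGroundState.lean`, l.302; not imported here only because its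
import cone — `…Negative.CentrosymmetricShell` — was unbuilt on the farm when this node was checked):

  `StrictSplittingRule → ∀ δ > 0, ∃ c > 0, ∀ P : PeriodicConfiguration 3, P.motif.card = 1 →
     (P.points δ-separated) → eInf + c ≤ P.energyPerParticle lennardJones`

i.e. `12560` as typed — strictness on ALL `δ`-separated configurations — forces ONE constant `c = c(a/5) > 0`
below the excess energy of EVERY `δ`-separated Bravais lattice, so `c(a/5) ≤ inf_Λ e(Λ) − e_∞ ≈ e*_fcc − e*_hcp ≈
7.25·10⁻⁵` (refuter evidence `lattice_check.out`; `Lines/close_packing.md` records c₁ ≤ 7.25e−5): the intrinsic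
scale of any witness of the crux.  Its corollary `StrictSplittingRule_false_of_bravaisGroundState` (same file,
l.339) kills the crux outright if some Bravais lattice (fcc) is a Lennard-Jones ground state.  The kernel
`K₁ … H` quantifies over GROUND STATES only and is not subject to the razor — it merely shares the BET
«hcp-type shells dominate», i.e. `e*_hcp < e*_fcc` (tree dependency `HcpFccLatticeSums*`, NEEDS-HUMAN build). -/

/-! ## Doctrine split of the kernel: `H ⟸ TP ∧ SEL`, both pieces not known to imply the conjunct -/

/-- The fcc first shell at spacing `a`: the twelve cuboctahedron vertices `fccKissingPattern` scaled by `a`. -/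
def fccTarget (a : ℝ) : Finset (EuclideanSpace ℝ (Fin 3)) :=
  fccKissingPattern.image fun u => a • u

/-- **TP (piece, WEAKER than H; COSTUME-class of 12086 `ZeroDefectDensity` ∧ 24071 `StrainRelease`)** —
TWO-PATTERN SHELL DEFECT VANISHING: for some hcp gauge `(a,t)` and fcc scale `a'`, every `η > 0`, along
every Lennard-Jones ground-state sequence the fraction of sites whose first shell is `η`-close NEITHER to
`S(a,t)` (radius `5a/4`) NOR to the fcc shell `a'·C` (radius `5a'/4`) tends to `0`. -/
@[conjecture] def TwoPatternShellDefectVanish : Prop :=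
  ∃ a t a' : ℝ, 0 < a ∧ |t| ≤ 1 / 100 ∧ 0 < a' ∧ ∀ η : ℝ, 0 < η →
    ∀ x : (N : ℕ) → (Fin N → EuclideanSpace ℝ (Fin 3)), (∀ N, IsGroundState lennardJones (x N)) →
      Tendsto (fun N : ℕ =>
        (Nat.card {k : Fin N // ¬ ShellCloseTo η (shell a (x N) k) (target a t) ∧
          ¬ ShellCloseTo η (shell a' (x N) k) (fccTarget a')} : ℝ) / N) atTop (𝓝 0)

/-- **SEL (piece, the POLYTYPE-SELECTION axis; COSTUME of F / 26655 / 3063)** — FCC SHELLS VANISH: for every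
scale `a' > 0` there is a tolerance `η₀ > 0` such that along every Lennard-Jones ground-state sequence the
fraction of sites whose `5a'/4`-shell is `η₀`-close to the fcc shell `a'·C` tends to `0`. -/
@[conjecture] def FccShellsVanish : Prop :=
  ∀ a' : ℝ, 0 < a' → ∃ η₀ : ℝ, 0 < η₀ ∧
    ∀ x : (N : ℕ) → (Fin N → EuclideanSpace ℝ (Fin 3)), (∀ N, IsGroundState lennardJones (x N)) →
      Tendsto (fun N : ℕ =>
        (Nat.card {k : Fin N // ShellCloseTo η₀ (shell a' (x N) k) (fccTarget a')} : ℝ) / N) atTop (𝓝 0)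

/-- Counting: if `p k → q k ∨ r k` then `#{k // p k} ≤ #{k // q k} + #{k // r k}` (as reals). [folklore] -/
theorem natCard_le_add_of_imp {N : ℕ} {p q r : Fin N → Prop} (h : ∀ k, p k → q k ∨ r k) :
    (Nat.card {k : Fin N // p k} : ℝ) ≤ (Nat.card {k : Fin N // q k} : ℝ) + Nat.card {k : Fin N // r k} := by
  rw [Nat.card_eq_fintype_card, Fintype.card_subtype, Nat.card_eq_fintype_card, Fintype.card_subtype,
    Nat.card_eq_fintype_card, Fintype.card_subtype]
  have hsub : (Finset.univ.filter fun k => p k) ⊆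
      (Finset.univ.filter fun k => q k) ∪ (Finset.univ.filter fun k => r k) := by
    intro k hk
    rw [Finset.mem_union, Finset.mem_filter, Finset.mem_filter]
    rcases h k (Finset.mem_filter.1 hk).2 with hq | hr
    · exact Or.inl ⟨Finset.mem_univ _, hq⟩
    · exact Or.inr ⟨Finset.mem_univ _, hr⟩
  exact_mod_cast (Finset.card_le_card hsub).trans (Finset.card_union_le _ _)

/-- **`TP ∧ SEL ⟹ H`**: a site with a non-`η`-hcp shell has, at the finer tolerance `η₁ = min η η₀`, either a
shell that is neither hcp- nor fcc-close (counted by TP) or an `η₁`-fcc shell, hence an `η₀`-fcc shell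
(counted by SEL). [folklore] -/
theorem hcpShellDefectVanish_of_twoPattern_of_fccVanish (hTP : TwoPatternShellDefectVanish)
    (hSEL : FccShellsVanish) : HcpShellDefectVanish := by
  -- `ShellCloseTo` is monotone in the tolerance (the tree's
  -- `PalmUnimodularRigidityMinimiserShells.Residual.shellCloseTo_mono`, inlined to keep this module's cone small)
  have shellCloseTo_mono : ∀ {η η' : ℝ}, η ≤ η' → ∀ {T P : Finset (EuclideanSpace ℝ (Fin 3))},
      ShellCloseTo η T P → ShellCloseTo η' T P := fun hη _ _ h => by
    obtain ⟨A, e, he⟩ := h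
    exact ⟨A, e, fun u => (he u).trans hη⟩
  obtain ⟨a, t, a', ha, ht, ha', hTP⟩ := hTP
  obtain ⟨η₀, hη₀, hSEL⟩ := hSEL a' ha'
  refine ⟨a, t, ha, ht, fun η hη x hx => ?_⟩
  set η₁ : ℝ := min η η₀ with hη₁_def
  have hη₁ : 0 < η₁ := lt_min hη hη₀
  have h1 := hTP η₁ hη₁ x hx
  have h2 := hSEL x hx
  have hbound : ∀ N : ℕ,
      (Nat.card {k : Fin N // ¬ ShellCloseTo η (shell a (x N) k) (target a t)} : ℝ) / N ≤
        (Nat.card {k : Fin N // ¬ ShellCloseTo η₁ (shell a (x N) k) (target a t) ∧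
            ¬ ShellCloseTo η₁ (shell a' (x N) k) (fccTarget a')} : ℝ) / N +
          (Nat.card {k : Fin N // ShellCloseTo η₀ (shell a' (x N) k) (fccTarget a')} : ℝ) / N := by
    intro N
    rw [← add_div]
    refine div_le_div_of_nonneg_right (natCard_le_add_of_imp fun k hk => ?_) (Nat.cast_nonneg N)
    by_cases hf : ShellCloseTo η₁ (shell a' (x N) k) (fccTarget a')
    · exact Or.inr (shellCloseTo_mono (min_le_right η η₀) hf)
    · exact Or.inl ⟨fun hc => hk (shellCloseTo_mono (min_le_left η η₀) hc), hf⟩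
  refine squeeze_zero' (Eventually.of_forall fun N => by positivity) (Eventually.of_forall hbound) ?_
  have hlim := h1.add h2
  rwa [add_zero] at hlim

/-- **`H ⟹ TP`** (so TP is WEAKER-or-equal; strictly weaker because TP admits fcc-dominated ground states,
which H excludes): take `a' := a`. [folklore] -/
theorem twoPattern_of_hcpShellDefectVanish (h : HcpShellDefectVanish) : TwoPatternShellDefectVanish := by
  -- counting `p k → q k ⇒ #{p} ≤ #{q}` (the tree's `…TwoLevel.natCard_fin_subtype_mono`, inlined)
  have natCard_le_of_imp : ∀ {N : ℕ} {p q : Fin N → Prop}, (∀ k, p k → q k) →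
      (Nat.card {k : Fin N // p k} : ℝ) ≤ (Nat.card {k : Fin N // q k} : ℝ) := fun {N p q} h => by
    rw [Nat.card_eq_fintype_card, Fintype.card_subtype, Nat.card_eq_fintype_card, Fintype.card_subtype]
    exact_mod_cast Finset.card_le_card fun k hk =>
      Finset.mem_filter.2 ⟨Finset.mem_univ _, h k (Finset.mem_filter.1 hk).2⟩
  obtain ⟨a, t, ha, ht, hH⟩ := h
  refine ⟨a, t, a, ha, ht, ha, fun η hη x hx => ?_⟩
  refine squeeze_zero' (Eventually.of_forall fun N => by positivity)
    (Eventually.of_forall fun N => div_le_div_of_nonneg_right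
      (natCard_le_of_imp fun k hk => hk.1) (Nat.cast_nonneg N)) (hH η hη x hx)

/-- **Node assembly (conjunct BY NAME from the doctrine pieces):** `TP ∧ SEL ⟹ Crystallization` given the
PROVED route items `ShellRigidityHcp`, `DefectVanishCrystallizes`, `DefectVanishEnergy`, `PeriodicUpperBound`
(binders as in `closes`). [folklore] -/
theorem crystallization_of_twoPattern_of_fccVanish (hTP : TwoPatternShellDefectVanish)
    (hSEL : FccShellsVanish) (h₂ : ShellRigidityHcp) (h₄ : DefectVanishCrystallizes) (h₅ : DefectVanishEnergy)
    (h₆ : PeriodicUpperBound) : _root_.Crystallization :=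
  crystallization_of_hcpShellDefectVanish (hcpShellDefectVanish_of_twoPattern_of_fccVanish hTP hSEL) h₂ h₄ h₅ h₆


/-! ## Outright corollaries: the four proved route items discharged by name -/

/-- **H → Crystallization OUTRIGHT**: `HcpShellDefectVanish` alone implies the conjunct `Crystallization`, the route
items `ShellRigidityHcp`, `DefectVanishCrystallizes`, `DefectVanishEnergy`, `PeriodicUpperBound` being PROVED tree
theorems (`shellRigidityHcp_proof`, `defectVanishCrystallizes_proof`, `defectVanishEnergy_proof`,
`periodicUpperBound_proof`). [folklore] -/
theorem crystallization_of_hcpShellDefectVanish_outright (h : HcpShellDefectVanish) : _root_.Crystallization :=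
  crystallization_of_hcpShellDefectVanish h shellRigidityHcp_proof
    FreeSplittingCertificatesDefectVanishCrystallizes.defectVanishCrystallizes_proof defectVanishEnergy_proof
    periodicUpperBound_proof

/-- **12560 → Crystallization OUTRIGHT**: the crux `StrictSplittingRule` alone closes the conjunct (through the kernel
H; every other binder of the route's `closes` is a tree theorem). [folklore] -/
theorem crystallization_of_strictSplittingRule_outright (h : StrictSplittingRule) : _root_.Crystallization :=
  crystallization_of_hcpShellDefectVanish_outright (hcpShellDefectVanish_of_strictSplittingRule h)

/-- **TP ∧ SEL → Crystallization OUTRIGHT** (the doctrine split of the kernel, with the proved items discharged).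
[folklore] -/
theorem crystallization_of_twoPattern_of_fccVanish_outright (hTP : TwoPatternShellDefectVanish)
    (hSEL : FccShellsVanish) : _root_.Crystallization :=
  crystallization_of_hcpShellDefectVanish_outright (hcpShellDefectVanish_of_twoPattern_of_fccVanish hTP hSEL)

end Summit.AtomisticToContinuum.Crystallization.Theorems.StrictSplittingOnPathKernel

end
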